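import Literature.Analysis.FluidPDE.CollisionalTransfer
import Literature.Analysis.FluidPDE.CollisionalTransferFunctionalMeasurable
import Literature.Analysis.FluidPDE.HardSphereCollisionRecord
import Literature.MathematicalPhysics.KineticTheory.HardSphereTwoTimePressure
import Literature.MathematicalPhysics.KineticTheory.HardSphereEulerProofs
import HarnessLib

/-!
# The exact quartic ledger along the hard-sphere flow (stub L of the line `quartic-schur-ledger`,
# crux `EnergyCurrentTails`, stmt-AtomisticToContinuum-9235)

Stub worker file for the registered stub `stub_quarticLedger` of the line lead's skeleton
`Cruxes/EnergyCurrentTails/Lines/quartic-schur-ledger.lean` (primary crux decl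
`Summit.AtomisticToContinuum.HydrodynamicLimit.Theses.WarmColdDichotomy.EnergyCurrentTails`, route
copy `…Theses.OneFlightGossipEngine.EnergyCurrentTails`).  The statement only mentions the
Literature prelude (`T3`, `V3`, `hsDiameter`, `localGibbsLaw`, `HardSphereFlow.collisionSum`), so no
`Summits` module is imported.

**Statement.**  For `0 < σ < 1/2`, every `N`, every hard-sphere flow `Φ` of `N + 1` spheres of
diameter `hsDiameter σ N` on `𝕋³`, and `0 ≤ s ≤ s'`, with `λ_N = localGibbsLaw σ a₀ u₀ θ₀ N Φ`,
`y(r) = ∫ (N+1)⁻¹ ∑ᵢ ‖vᵢ(r)‖⁴ dλ_N` and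
`Gain/Loss(s,s'] = ∫ (N+1)⁻¹ collisionSum_{(s,s']} (Δ₄)±/2 dλ_N`
(`Δ₄(col) = ‖v₁⁺‖⁴ + ‖v₂⁺‖⁴ − ‖v₁⁻‖⁴ − ‖v₂⁻‖⁴` of a collision record; ORDERED contact pairs count
each binary collision twice, whence `/2`):  `y(s') + Loss(s,s'] = y(s) + Gain(s,s']` in `ℝ≥0∞`.

**Proof.**  Pure kinematics + Tonelli.  Along a hard-sphere trajectory (`z ∈ Φ.good`) the quartic
observable `F₄(w) = ∑ᵢ ‖(w i).2‖⁴` is constant on free flights (`freeFlight_apply`), so the weak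
balance law `IsHardSphereTrajectory.sub_eq_integral_add_collisionalTransfer` with streaming
derivative `0` gives `F₄(γ s') − F₄(γ s) = collisionalTransfer F₄`.  By
`collisionalTransferFunctional_jumpKernel` + `collisionalTransferFunctional_eq_collisionSum`
(regular torus geometry, `Torus.isHardSphereRegular_geometry` for `hsDiameter σ N ≤ σ < 1/2`) the
transfer is the collision sum of `Δ₄/2` over the records (`collisionJump_quarticSum`: at a binary
collision only the pair jumps, `apply_eq_leftLim_apply_of_ne`; `ofConfig_preVel_eq_leftLim`,
`ofConfig_postVel`).  Then `(x)₊ = x + (−x)₊` splits `Δ₄/2` into gain minus loss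
(`collisionPairSum_add`), all four terms are `≥ 0`, `ENNReal.ofReal` is additive on them, and
`lintegral_add_left` (measurability of the `y`-integrand only, `HardSphereFlow.measurable_flow`) +
`lintegral_congr_ae` over `ae_mem_good_localGibbsLaw` integrate the pointwise identity.  No
integrability of the collision sums is needed.

References: Cercignani–Illner–Pulvirenti 1994 §4.2 (elastic collisions, weak form along
trajectories); Bobylev 1997 / Mischler–Wennberg 1999 (Povzner-type quartic bookkeeping).
-/

noncomputable section

open MeasureTheory Set Filter
open scoped ENNReal InnerProductSpace

namespace Summit.AtomisticToContinuum.HydrodynamicLimit.Theorems.QuarticSchurLedger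

open Literature.MathematicalPhysics.KineticTheory Literature.Analysis.FluidPDE

section Trajectory

variable {d : Type*} [Fintype d] {X : Type*} [TopologicalSpace X] [T2Space X] {n : ℕ}
  {G : Geometry d X} {ε : ℝ} {γ : ℝ → Config n d X}

/-- **The jump of the quartic observable at a binary collision.**  At a collision of the pair
`{i, j}` of a hard-sphere trajectory only the pair's velocities jump
(`IsHardSphereTrajectory.apply_eq_leftLim_apply_of_ne`), so the jump of `w ↦ ∑ₖ ‖(w k).2‖⁴` is
`‖vᵢ⁺‖⁴ + ‖vⱼ⁺‖⁴ − ‖vᵢ⁻‖⁴ − ‖vⱼ⁻‖⁴`. [folklore] -/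
theorem collisionJump_quarticSum (h : IsHardSphereTrajectory G ε n γ) {t : ℝ} {i j : Fin n}
    (hij : i ≠ j) (hc : γ t ∈ contactSet G n ε i j) :
    collisionJump (fun w : Config n d X => ∑ k, ‖(w k).2‖ ^ 4) γ t =
      ‖(γ t i).2‖ ^ 4 + ‖(γ t j).2‖ ^ 4
        - ‖(Function.leftLim γ t i).2‖ ^ 4 - ‖(Function.leftLim γ t j).2‖ ^ 4 := by
  have hdiff : collisionJump (fun w : Config n d X => ∑ k, ‖(w k).2‖ ^ 4) γ t =
      ∑ k, (‖(γ t k).2‖ ^ 4 - ‖(Function.leftLim γ t k).2‖ ^ 4) := by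
    simp only [collisionJump, Finset.sum_sub_distrib]
  rw [hdiff, Fintype.sum_eq_add i j hij]
  · ring
  · intro k hk
    rw [h.apply_eq_leftLim_apply_of_ne hij hc hk.1 hk.2, sub_self]

/-- **The collisional transfer of the quartic observable is the collision sum of `Δ₄/2`.**  In a
regular geometry the ordered contact pairs at a collision of `{p, q}` are `(p, q)` and `(q, p)`,
each record carrying the same `Δ₄ = ‖v₁⁺‖⁴ + ‖v₂⁺‖⁴ − ‖v₁⁻‖⁴ − ‖v₂⁻‖⁴` (post-velocities read off
`γ t`, pre-velocities the left limits, `IsHardSphereTrajectory.ofConfig_preVel_eq_leftLim`), i.e.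
half the jump each (`collisionalTransferFunctional_jumpKernel`). [folklore] -/
theorem collisionalTransfer_quarticSum_eq_collisionSum (h : IsHardSphereTrajectory G ε n γ)
    (hG : G.IsHardSphereRegular ε) (a b : ℝ) :
    collisionalTransfer G ε (fun w : Config n d X => ∑ k, ‖(w k).2‖ ^ 4) γ a b =
      collisionSum G ε γ (Ioc a b) fun col =>
        (‖col.postVel.1‖ ^ 4 + ‖col.postVel.2‖ ^ 4
          - ‖col.preVel.1‖ ^ 4 - ‖col.preVel.2‖ ^ 4) / 2 := by
  rw [← h.collisionalTransferFunctional_jumpKernel]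
  refine collisionalTransferFunctional_eq_collisionSum hG fun t _ p hp => ?_
  obtain ⟨i, j⟩ := p
  obtain ⟨hij, hc⟩ := mem_contactPairs.1 hp
  rw [h.ofConfig_preVel_eq_leftLim hp]
  change (2 : ℝ)⁻¹ • collisionJump (fun w : Config n d X => ∑ k, ‖(w k).2‖ ^ 4) γ t = _
  rw [collisionJump_quarticSum h hij hc]
  simp only [HardSphereCollisionRecord.ofConfig_postVel, smul_eq_mul]
  ring

/-- Splitting a real number into positive and negative parts, halved:
`(p − q)₊/2 = (p − q)/2 + (q − p)₊/2` in the four-term form of the quartic increment. [folklore] -/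
theorem posPart_half_eq_add (p₁ p₂ q₁ q₂ : ℝ) :
    max (p₁ + p₂ - q₁ - q₂) 0 / 2 = (p₁ + p₂ - q₁ - q₂) / 2 + max (q₁ + q₂ - p₁ - p₂) 0 / 2 := by
  have hneg : q₁ + q₂ - p₁ - p₂ = -(p₁ + p₂ - q₁ - q₂) := by ring
  rw [hneg]
  linarith [max_zero_sub_max_neg_zero_eq_self (p₁ + p₂ - q₁ - q₂)]

/-- **The pathwise quartic ledger** along a hard-sphere trajectory in a regular geometry: for
`a ≤ b`, `∑ₖ ‖vₖ(b)‖⁴ + ½ collisionSum_{(a,b]} (Δ₄)₋ = ∑ₖ ‖vₖ(a)‖⁴ + ½ collisionSum_{(a,b]} (Δ₄)₊`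
(velocities are constant on free flights, so the weak balance law has no streaming term; the
collisional term is the collision sum of `Δ₄/2`, split into its positive and negative parts).
[folklore] -/
theorem quarticSum_add_collisionSum_eq (h : IsHardSphereTrajectory G ε n γ)
    (hG : G.IsHardSphereRegular ε) {a b : ℝ} (hab : a ≤ b) :
    (∑ k, ‖(γ b k).2‖ ^ 4) +
        collisionSum G ε γ (Ioc a b) (fun col =>
          max (‖col.preVel.1‖ ^ 4 + ‖col.preVel.2‖ ^ 4
            - ‖col.postVel.1‖ ^ 4 - ‖col.postVel.2‖ ^ 4) 0 / 2) =
      (∑ k, ‖(γ a k).2‖ ^ 4) +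
        collisionSum G ε γ (Ioc a b) (fun col =>
          max (‖col.postVel.1‖ ^ 4 + ‖col.postVel.2‖ ^ 4
            - ‖col.preVel.1‖ ^ 4 - ‖col.preVel.2‖ ^ 4) 0 / 2) := by
  -- the weak balance law with vanishing streaming derivative
  have hF : ∀ (z : Config n d X) (t : ℝ),
      HasDerivAt (fun s => ∑ k, ‖(freeFlight G s z k).2‖ ^ 4) (0 : ℝ) t := fun z t => by
    simp only [freeFlight_apply]
    exact hasDerivAt_const t _
  have hbal := (h.sub_eq_integral_add_collisionalTransfer
    (F := fun w : Config n d X => ∑ k, ‖(w k).2‖ ^ 4) (F' := fun _ : Config n d X => (0 : ℝ))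
    hG.continuous_translate_left hF (fun _ => continuous_const) hab).2
  simp only [intervalIntegral.integral_zero, zero_add] at hbal
  rw [collisionalTransfer_quarticSum_eq_collisionSum h hG a b] at hbal
  -- split `Δ₄/2 = (Δ₄)₊/2 - (Δ₄)₋/2`
  have hfin := h.finite_collisionTimes_inter_Ioc a b
  have hsplit : collisionSum G ε γ (Ioc a b) (fun col =>
        max (‖col.postVel.1‖ ^ 4 + ‖col.postVel.2‖ ^ 4
          - ‖col.preVel.1‖ ^ 4 - ‖col.preVel.2‖ ^ 4) 0 / 2) =
      collisionSum G ε γ (Ioc a b) (fun col =>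
        (‖col.postVel.1‖ ^ 4 + ‖col.postVel.2‖ ^ 4
          - ‖col.preVel.1‖ ^ 4 - ‖col.preVel.2‖ ^ 4) / 2) +
      collisionSum G ε γ (Ioc a b) (fun col =>
        max (‖col.preVel.1‖ ^ 4 + ‖col.preVel.2‖ ^ 4
          - ‖col.postVel.1‖ ^ 4 - ‖col.postVel.2‖ ^ 4) 0 / 2) := by
    simp only [collisionSum_eq_collisionPairSum]
    rw [← collisionPairSum_add hfin]
    congr 1
    funext t i j
    exact posPart_half_eq_add _ _ _ _
  linarith

end Trajectory

/-- Measurability of the normalised quartic integrand `z ↦ ofReal ((N+1)⁻¹ ∑ᵢ ‖vᵢ(r)‖⁴)` along a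
hard-sphere flow (each `Φ.flow r` is measurable). [folklore] -/
theorem measurable_ofReal_quarticSum_flow {N : ℕ} {ε : ℝ}
    (Φ : HardSphereFlow (Torus.geometry (Fin 3)) ε (N + 1)) (r : ℝ) :
    Measurable fun z : Config (N + 1) (Fin 3) T3 =>
      ENNReal.ofReal (((N : ℝ) + 1)⁻¹ * ∑ i : Fin (N + 1), ‖(Φ.flow r z i).2‖ ^ 4) := by
  refine ENNReal.measurable_ofReal.comp (Measurable.const_mul ?_ _)
  refine Finset.measurable_sum _ fun i _ => ?_
  exact (((measurable_pi_apply i).comp (Φ.measurable_flow r)).snd.norm).pow_const 4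

/-- **Stub L — THE QUARTIC LEDGER (exact, in expectation)** of the line `quartic-schur-ledger`
(crux stmt-AtomisticToContinuum-9235, `EnergyCurrentTails`).  For `0 < σ < 1/2`, every `N`, every
hard-sphere flow `Φ` and `0 ≤ s ≤ s′`:  `y(s′) + Loss(s,s′] = y(s) + Gain(s,s′]` as extended
non-negative reals, where `y(r) = ∫ (N+1)⁻¹ ∑ᵢ ‖vᵢ(r)‖⁴ dλ_N` and `Gain`/`Loss` are the expected
normalised collision sums of `(Δ₄)±/2` over the collision records of the window `(s, s′]`.
Pathwise on `Φ.good` this is `quarticSum_add_collisionSum_eq` (regular torus geometry since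
`hsDiameter σ N ≤ σ < 1/2`); `ENNReal.ofReal` is additive on the four non-negative terms, and the
identity integrates by `lintegral_add_left` (measurability of the `y`-integrand only) and
`lintegral_congr_ae` over the `λ_N`-conull good set (`ae_mem_good_localGibbsLaw`). [folklore] -/
theorem stub_quarticLedger :
    ∀ (a₀ θ₀ : T3 → ℝ) (u₀ : T3 → V3) (σ : ℝ), 0 < σ → σ < 1 / 2 →
      ∀ (N : ℕ) (Φ : HardSphereFlow (Torus.geometry (Fin 3)) (hsDiameter σ N) (N + 1)) (s s' : ℝ),
        0 ≤ s → s ≤ s' →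
          (∫⁻ z, ENNReal.ofReal (((N : ℝ) + 1)⁻¹ * ∑ i : Fin (N + 1), ‖(Φ.flow s' z i).2‖ ^ 4)
              ∂(localGibbsLaw σ a₀ u₀ θ₀ N Φ)) +
            (∫⁻ z, ENNReal.ofReal (((N : ℝ) + 1)⁻¹ *
                Φ.collisionSum (Set.Ioc s s')
                  (fun col => max (‖col.preVel.1‖ ^ 4 + ‖col.preVel.2‖ ^ 4
                    - ‖col.postVel.1‖ ^ 4 - ‖col.postVel.2‖ ^ 4) 0 / 2) z)
              ∂(localGibbsLaw σ a₀ u₀ θ₀ N Φ))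
          = (∫⁻ z, ENNReal.ofReal (((N : ℝ) + 1)⁻¹ * ∑ i : Fin (N + 1), ‖(Φ.flow s z i).2‖ ^ 4)
              ∂(localGibbsLaw σ a₀ u₀ θ₀ N Φ)) +
            (∫⁻ z, ENNReal.ofReal (((N : ℝ) + 1)⁻¹ *
                Φ.collisionSum (Set.Ioc s s')
                  (fun col => max (‖col.postVel.1‖ ^ 4 + ‖col.postVel.2‖ ^ 4
                    - ‖col.preVel.1‖ ^ 4 - ‖col.preVel.2‖ ^ 4) 0 / 2) z)
              ∂(localGibbsLaw σ a₀ u₀ θ₀ N Φ)) := by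
  intro a₀ θ₀ u₀ σ hσ hσ2 N Φ s s' _hs hss'
  have hε : hsDiameter σ N < 2⁻¹ := (hsDiameter_le hσ.le N).trans_lt (by linarith)
  have hG : (Torus.geometry (Fin 3)).IsHardSphereRegular (hsDiameter σ N) :=
    Torus.isHardSphereRegular_geometry hε
  have hc : (0 : ℝ) ≤ ((N : ℝ) + 1)⁻¹ := by positivity
  rw [← lintegral_add_left (measurable_ofReal_quarticSum_flow Φ s'),
    ← lintegral_add_left (measurable_ofReal_quarticSum_flow Φ s)]
  refine lintegral_congr_ae ?_
  filter_upwards [ae_mem_good_localGibbsLaw σ a₀ u₀ θ₀ N Φ] with z hz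
  have hγ := Φ.isTrajectory z hz
  have hled := quarticSum_add_collisionSum_eq hγ hG hss'
  -- non-negativity of the four terms
  have hY' : 0 ≤ ((N : ℝ) + 1)⁻¹ * ∑ i : Fin (N + 1), ‖(Φ.flow s' z i).2‖ ^ 4 :=
    mul_nonneg hc (Finset.sum_nonneg fun i _ => by positivity)
  have hY : 0 ≤ ((N : ℝ) + 1)⁻¹ * ∑ i : Fin (N + 1), ‖(Φ.flow s z i).2‖ ^ 4 :=
    mul_nonneg hc (Finset.sum_nonneg fun i _ => by positivity)
  have hL : 0 ≤ ((N : ℝ) + 1)⁻¹ * Φ.collisionSum (Set.Ioc s s')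
      (fun col => max (‖col.preVel.1‖ ^ 4 + ‖col.preVel.2‖ ^ 4
        - ‖col.postVel.1‖ ^ 4 - ‖col.postVel.2‖ ^ 4) 0 / 2) z := by
    refine mul_nonneg hc ?_
    rw [HardSphereFlow.collisionSum_eq, collisionSum_eq_collisionPairSum]
    exact collisionPairSum_nonneg fun _ _ _ => by positivity
  have hGn : 0 ≤ ((N : ℝ) + 1)⁻¹ * Φ.collisionSum (Set.Ioc s s')
      (fun col => max (‖col.postVel.1‖ ^ 4 + ‖col.postVel.2‖ ^ 4
        - ‖col.preVel.1‖ ^ 4 - ‖col.preVel.2‖ ^ 4) 0 / 2) z := by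
    refine mul_nonneg hc ?_
    rw [HardSphereFlow.collisionSum_eq, collisionSum_eq_collisionPairSum]
    exact collisionPairSum_nonneg fun _ _ _ => by positivity
  rw [← ENNReal.ofReal_add hY' hL, ← ENNReal.ofReal_add hY hGn, ← mul_add, ← mul_add,
    HardSphereFlow.collisionSum_eq, HardSphereFlow.collisionSum_eq, hled]

end Summit.AtomisticToContinuum.HydrodynamicLimit.Theorems.QuarticSchurLedger
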